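import Summits.HodgeConjecture.FermatCycles.ConditionQPrimeToSixFourfold
import Summits.HodgeConjecture.HodgeConjecture.Theorems.PadicSemiregularLiftHodgeFermatVarietiesExistsFibreOfNotPairedPow
import HarnessLib

/-!
# Shioda's method at prime-power degree `pᵏ` (`p ≥ 5`, `k ≥ 2`): `(Qⁿ) ⟺ (Pⁿ) ⟺ n + 2 ≤ p` (companion of `ConditionQPrimeToSix`)

HONEST FRAMING: explicit algebraic cycles for specific Hodge classes on Fermat/Delsarte varieties;
residual open instances listed; no claim on general Hodge.

Topic path `Summits/HodgeConjecture/FermatCycles/` of cell `pub-hfermat`. `ConditionQPrimeToSix{,Fourfold}.lean` settle Shioda's conditions at levels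
prime to `6` in all lengths together (`(Qₘ) ⟺ m` prime) and in length `≤ 6` (`(Q⁴ₘ) ⟺ ¬(5 ∣ m ∧ m > 5)`). THIS FILE gives the exact threshold in
the DIMENSION at a prime-power level `m = pᵏ`, `p ≥ 5` prime, `k ≥ 2` (for `k = 1` both conditions hold in every dimension — Parry's lemma):

**`(Qⁿ_{pᵏ}) ⟺ (Pⁿ_{pᵏ}) ⟺ n + 2 ≤ p`** (`primePow_iff`): Shioda's method for `Xⁿ_{pᵏ}`, original [Shioda1979HodgeFermat, Thm IV] or stable
[loc. cit. §4], works exactly in dimensions `n ≤ p − 2` (e.g. `X⁴₄₉`: yes; `X⁶₄₉`, `X⁴₂₅`: no). INPUT (a theorem of the tree, line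
`cancel-by-any-claim-lattice`, programme GS²: `PairedNull.stub_exists_fibre_of_not_paired_pow`, [Aoki1983, Thm A′ §7, Prop. 2.2, Prop. 6.4]): at a
level prime to `6` all of whose prime factors other than `p` exceed `#s + 2`, a non-symmetric Hodge multiset `s` contains all but one of the `p`
points `A + j(m/p)` of a progression with `pA ≠ 0`. At `m = pᵏ` the side condition is vacuous; if moreover `#s ≤ p − 1` then `s` IS those `p − 1`
points (`ConditionQPrimeToSix.progression_le`), and its sum `(p−1)A + c·(m/p)` is non-zero since `p·` it is `(p−1)·pA` with `p − 1` a unit modulo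
`pᵏ` — so every Hodge multiset with `#s ≤ p − 1` (equivalently, by parity, `#s ≤ p`) is symmetric (`isSymmetric_of_card_le_primePow`), hence
`Q + (−Q)`, hence decomposable and in `M'ₘ`. Conversely for `n ≥ p − 1` Aoki's `σ_{p,1}` (`p + 1` entries, `m/p = pᵏ⁻¹ ≥ 3`) refutes `(Qⁿₘ)`
(`ConditionQPrimeToSix.coprimeSix_consequences`). Consistent with [Aoki1983, Thm A] (`𝔅ⁿₘ = 𝔇ⁿₘ` iff every prime factor of `m` exceeds `n + 2`,
for `m` neither prime nor `4`). No hypothesis, no fact, no `sorry`.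

References: [Shioda1979HodgeFermat] T. Shioda, Math. Ann. 245 (1979) §4; [Aoki1983] N. Aoki, Math. Ann. 266 (1983) 23–54, Thm A, Thm A′ (§7);
[Aoki1987] N. Aoki, J. Math. Soc. Japan 39 (1987) §1 (σ_{p,i}).
-/

namespace Summit.HodgeConjecture.FermatCycles.ConditionQPrimePower

open Multiset
open Literature.AlgebraicGeometry.HodgeTheory Literature.AlgebraicGeometry.HodgeTheory.FermatCharacter
open Literature.AlgebraicGeometry.Shioda1979 Literature.AlgebraicGeometry.Shioda1981
open Summit.HodgeConjecture.FermatCycles.ConditionQSymmetric Summit.HodgeConjecture.FermatCycles.ConditionQCoprimeSix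
open Summit.HodgeConjecture.FermatCycles.ConditionQPrimeToSix Summit.HodgeConjecture.FermatCycles.ConditionQPrimeToSixFourfold
open Summit.HodgeConjecture.HodgeConjecture.Theorems.CancelByAnyClaimLattice

variable {p k : ℕ}

/-- `p - 1` is prime to `p` (for `p ≥ 1`). [folklore] -/
theorem coprime_sub_one_self (hp : 1 ≤ p) : Nat.Coprime (p - 1) p := by
  have h := (Nat.coprime_add_self_right (m := p - 1) (n := 1)).mpr (Nat.coprime_one_right _)
  rwa [show 1 + (p - 1) = p by omega] at h

/-- A prime `p ≥ 5` and its powers are prime to `6`. [folklore] -/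
theorem coprime_six_primePow (hp : p.Prime) (hp5 : 5 ≤ p) (k : ℕ) : Nat.Coprime (p ^ k) 6 := by
  apply Nat.Coprime.pow_left
  have h2 : Nat.Coprime p 2 := (Nat.coprime_primes hp Nat.prime_two).mpr (by omega)
  have h3 : Nat.Coprime p 3 := (Nat.coprime_primes hp Nat.prime_three).mpr (by omega)
  have h := Nat.Coprime.mul_right h2 h3
  norm_num at h
  exact h

/-- **At `m = pᵏ` (`p ≥ 5` prime, `k ≥ 1`) every Hodge multiset with at most `p − 1` entries is symmetric.** By the tree's
`PairedNull.stub_exists_fibre_of_not_paired_pow` a non-symmetric one contains `p − 1` distinct points `A + j pᵏ⁻¹` (`pA ≠ 0`), hence consists of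
them, and `p ·` its (vanishing) sum is `(p − 1)·pA ≠ 0`. [cite: Aoki1983, Thm A′ (§7)] -/
theorem isSymmetric_of_card_le_primePow (hp : p.Prime) (hp5 : 5 ≤ p) (hk : 1 ≤ k) [NeZero (p ^ k)]
    {s : Multiset (ZMod (p ^ k))} (hs : IsHodgeMultiset s) (hcard : card s ≤ p - 1) : IsSymmetric s := by
  have h6 := coprime_six_primePow hp hp5 k
  have hpm : p ∣ p ^ k := dvd_pow_self p (by omega)
  by_contra hns
  obtain ⟨x, hx⟩ : ∃ x, count x s ≠ count (-x) s := by
    by_contra hall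
    push Not at hall
    exact hns hall
  have hbig : ∀ q ∈ (p ^ k).primeFactors, q ≠ p → card s + 3 ≤ q := by
    intro q hq hqp
    rw [Nat.primeFactors_prime_pow (by omega) hp, Finset.mem_singleton] at hq
    exact absurd hq hqp
  obtain ⟨-, A, hA, j₀, hj₀, hfib⟩ :=
    PairedNull.stub_exists_fibre_of_not_paired_pow p hp hp5 (p ^ k) h6 s hs hbig ⟨x, hx⟩
  -- the `p - 1` progression points fill `s`
  set S : Finset ℕ := (Finset.range p).erase j₀ with hS_def
  have hSlt : ∀ j ∈ S, j < p := fun j hj ↦ Finset.mem_range.mp (Finset.mem_of_mem_erase hj)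
  have hSmem : ∀ j ∈ S, A + (j : ZMod (p ^ k)) * ((p ^ k / p : ℕ) : ZMod (p ^ k)) ∈ s := fun j hj ↦
    hfib j (hSlt j hj) (Finset.ne_of_mem_erase hj)
  have hle := progression_le hpm S hSlt s hSmem
  have hScard : S.card = p - 1 := by
    rw [hS_def, Finset.card_erase_of_mem (Finset.mem_range.mpr hj₀), Finset.card_range]
  have heq := Multiset.eq_of_le_of_card_le hle (by rw [Multiset.card_map, Finset.card_val, hScard]; exact hcard)
  -- its sum vanishes: `(p-1)•A + c·(m/p) = 0`
  have hsum := hs.1.2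
  rw [← heq, Multiset.sum_map_add, Multiset.sum_map_mul_right, Multiset.map_const', Multiset.sum_replicate, Finset.card_val,
    hScard, nsmul_eq_mul] at hsum
  have hpd : (p : ZMod (p ^ k)) * ((p ^ k / p : ℕ) : ZMod (p ^ k)) = 0 := by
    rw [← Nat.cast_mul, Nat.mul_div_cancel' hpm, ZMod.natCast_self]
  have hu : IsUnit ((p - 1 : ℕ) : ZMod (p ^ k)) := by
    have hc : Nat.Coprime (p - 1) (p ^ k) := (coprime_sub_one_self hp.one_lt.le).pow_right k
    have h := (ZMod.unitOfCoprime (p - 1) hc).isUnit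
    rwa [ZMod.coe_unitOfCoprime] at h
  apply hA
  have e : ((p - 1 : ℕ) : ZMod (p ^ k)) * ((p : ZMod (p ^ k)) * A) = 0 := by
    linear_combination (p : ZMod (p ^ k)) * hsum
      - (Multiset.map (fun j : ℕ ↦ (j : ZMod (p ^ k))) S.val).sum * hpd
  exact hu.mul_right_eq_zero.mp e

/-- **Shioda's method at prime-power degree: `(Qⁿ_{pᵏ}) ⟺ (Pⁿ_{pᵏ}) ⟺ n + 2 ≤ p`** for `p ≥ 5` prime, `k ≥ 2`. If `n + 2 ≤ p`, a Hodge multiset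
with `6 ≤ #s ≤ n + 2 ≤ p` entries has (parity) `#s ≤ p − 1`, so is symmetric, `= Q + (−Q)`, decomposable and in `M'ₘ`; if `n ≥ p − 1`, Aoki's
`σ_{p,1}` refutes `(Qⁿₘ)`, hence `(Pⁿₘ)`. [cite: Shioda1979HodgeFermat, §4 pp. 183–184] [cite: Aoki1983, Thm A and Thm A′ (§7)] [cite: Aoki1987, §1 p. 387] -/
theorem primePow_iff (hp : p.Prime) (hp5 : 5 ≤ p) (hk : 2 ≤ k) (n : ℕ) :
    (ConditionQ (p ^ k) n ↔ n + 2 ≤ p) ∧ (ShiodaConditionUpTo (p ^ k) n ↔ n + 2 ≤ p) := by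
  haveI : NeZero (p ^ k) := ⟨(pow_pos hp.pos k).ne'⟩
  have h6 := coprime_six_primePow hp hp5 k
  have hpm : p ∣ p ^ k := dvd_pow_self p (by omega)
  -- `n + 2 ≤ p` ⇒ `(Pⁿ)`
  have hP : n + 2 ≤ p → ShiodaConditionUpTo (p ^ k) n := by
    intro hnp s hs h6le hle
    obtain ⟨c, hc⟩ := hs.even_card
    have hcard : card s ≤ p - 1 := by
      obtain ⟨r, hr⟩ := hp.odd_of_ne_two (by omega)
      omega
    have hsym := isSymmetric_of_card_le_primePow hp hp5 (by omega) hs hcard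
    obtain ⟨Q, hQ0, rfl⟩ := CoprimeSix.exists_pairs_of_count_symm h6 _ s rfl hs hsym
    have hQcard : 3 ≤ card Q := by
      rw [Multiset.card_add, Multiset.card_map] at h6le
      omega
    obtain ⟨a, Q', rfl⟩ : ∃ a Q', Q = a ::ₘ Q' := by
      induction Q using Multiset.induction with
      | empty => simp at hQcard
      | cons a Q' _ => exact ⟨a, Q', rfl⟩
    have ha : a ≠ 0 := hQ0 a (Multiset.mem_cons_self a Q')
    have hQ'0 : ∀ b ∈ Q', b ≠ 0 := fun b hb ↦ hQ0 b (Multiset.mem_cons_of_mem hb)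
    have hQ'card : 2 ≤ card Q' := by rw [Multiset.card_cons] at hQcard; omega
    left
    refine ⟨{a, -a}, Q' + Q'.map (fun x ↦ -x), by simp, ?_, IsHodgeMultiset.pair ha,
      isHodgeMultiset_of_mem_mPrime (pairs_mem_mPrime Q' hQ'0), ?_⟩
    · intro h
      have := congrArg card h
      rw [Multiset.card_add, Multiset.card_map, Multiset.card_zero] at this
      omega
    · simp only [Multiset.map_cons, Multiset.cons_add, Multiset.add_cons, insert_eq_cons, singleton_add]
      rw [Multiset.cons_swap]
  -- `n ≥ p - 1` ⇒ `¬(Qⁿ)`: Aoki's `σ_{p,1}`, `p = 2r+1`, `m/p = p^(k-1) ≥ 3`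
  have hQ : ¬ n + 2 ≤ p → ¬ ConditionQ (p ^ k) n := by
    intro hnp
    obtain ⟨r, hr⟩ := hp.odd_of_ne_two (by omega)
    obtain ⟨k', rfl⟩ : ∃ k', k = k' + 2 := ⟨k - 2, by omega⟩
    have hdiv : p ^ (k' + 2) / p = p ^ (k' + 1) := by
      rw [show p ^ (k' + 2) = p * p ^ (k' + 1) by ring]
      exact Nat.mul_div_cancel_left _ hp.pos
    have hd : 3 ≤ p ^ (k' + 2) / (2 * r + 1) := by
      rw [← hr, hdiv]
      exact le_trans (by omega) (Nat.le_self_pow (by omega) p)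
    exact (coprimeSix_consequences h6).1 r n (by omega) (hr ▸ hpm) hd (by omega)
  constructor
  · constructor
    · intro hQn
      by_contra hnp
      exact hQ hnp hQn
    · intro hnp
      exact conditionQ_of_shiodaConditionUpTo (hP hnp)
  · constructor
    · intro hPn
      by_contra hnp
      exact hQ hnp (conditionQ_of_shiodaConditionUpTo hPn)
    · exact hP

end Summit.HodgeConjecture.FermatCycles.ConditionQPrimePower
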